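import Summits.Ventures.HodgeRepro2.T5HermitianLocalIsotropy
import Summits.Ventures.HodgeRepro2.T5StarOfInvolution
import Summits.Ventures.HodgeRepro2.T5UnitaryGroupIsometry

/-!
# The isotropy of `V_v` in the N3 lane's vocabulary: seat p8's `starRingOfQuadratic` and `sesqForm`
(cell pub-hodge-repro2, seat p3)

Tier-5 N3 support (LEAN-ANNEX-p8.md §108 / §110: «what stays prose: the isotropy of `V_v` (printed)»). Seat p8's
T5-141 `exists_congruent_J3_integral_of_isotropic_of_unramified` works on a quadratic extension `E / F` with the
star `T5StarOfInvolution.starRingOfQuadratic h2 σ hσ` (`star x = σ x`) and takes an isotropic vector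
`v ≠ 0`, `sesqForm H v v = 0` (`T5UnitaryGroupIsometry.sesqForm H v w = star v ⬝ᵥ H *ᵥ w`) as a hypothesis. File
179 proved the isotropy of every invertible hermitian form in `≥ 3` variables over `E_w` at every finite
non-split place, for this seat's star `localStarRing` (`star = localConj`, file 141). Here the two vocabularies
are matched on the completions, with `σ := localConj v w hs hspan hsq c` (the non-trivial `F_v`-automorphism of
`E_w`, `localConj_ne_one`) and `h2 := finrank_eq_two'`:
* `star_starRingOfQuadratic_localConj` — p8's star at `σ = localConj` is this seat's star, pointwise;
* `isHermitian_congr`, `sesqForm_self_eq_formVal` — `IsHermitian` and the form value transported along a pointwise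
  equality of stars;
* **`exists_sesqForm_eq_zero_localConj`** — on `E_w` at every finite non-split place of `F`, with p8's star at
  `σ = localConj`: every invertible hermitian matrix of size `≥ 3` has `x ≠ 0` with `sesqForm H x x = 0` — the
  hypothesis of T5-141, ready to instantiate (`R₀ := 𝒪_{F_v}`, `F := F_v`, `E := E_w`; the integrality and
  unramifiedness hypotheses are the N3 owner's).

Mathlib + this seat's files 141 / 179 + seat p8's T5-125 (T5StarOfInvolution) / T5-128 (T5UnitaryGroupIsometry)
and their imports; no display; no device. §8(d): uses an L-value-free non-vanishing device: NO.
-/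

namespace Summit.Ventures.HodgeRepro2.T5HermitianLocalIsotropyN3

open Matrix IsDedekindDomain IsDedekindDomain.HeightOneSpectrum NumberField Module
open Summit.Ventures.HodgeRepro2.T5HermitianDiagonalize Summit.Ventures.HodgeRepro2.T5FinitePlaceStar
  Summit.Ventures.HodgeRepro2.T5FinitePlaceNormIndex Summit.Ventures.HodgeRepro2.T5HermitianLocalIsotropy
  Summit.Ventures.HodgeRepro2.T5StarOfInvolution Summit.Ventures.HodgeRepro2.T5UnitaryGroupIsometry

/-! ## Transport along a pointwise equality of stars -/

section Transport

variable {E : Type*} [Field E]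

/-- `IsHermitian` depends on the star only through its values. -/
theorem isHermitian_congr {ι : Type*} (i₁ i₂ : StarRing E)
    (h : ∀ y : E, (letI := i₁; star y) = (letI := i₂; star y)) (H : Matrix ι ι E) :
    (letI := i₁; H.IsHermitian) ↔ (letI := i₂; H.IsHermitian) := by
  simp only [Matrix.IsHermitian, ← Matrix.ext_iff, Matrix.conjTranspose_apply, h]

/-- `sesqForm H x x` (seat p8) is `formVal H x` (this seat) when the two stars agree pointwise. -/
theorem sesqForm_self_eq_formVal {ι : Type*} [Fintype ι] (i₁ i₂ : StarRing E)
    (h : ∀ y : E, (letI := i₁; star y) = (letI := i₂; star y)) (H : Matrix ι ι E) (x : ι → E) :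
    (letI := i₁; sesqForm H x x) = (letI := i₂; formVal H x) := by
  simp only [sesqForm, formVal, dotProduct, Pi.star_apply, h]

end Transport

/-! ## On the completions, with `σ = localConj` -/

section Local

variable {F E : Type*} [Field F] [NumberField F] [Field E] [NumberField E] [Algebra F E]
  [Algebra.IsQuadraticExtension F E]
variable (v : HeightOneSpectrum (𝓞 F)) (w : HeightOneSpectrum (𝓞 E)) [w.asIdeal.LiesOver v.asIdeal]
variable {s : E} {θ : F}
variable (hs : s ^ 2 = algebraMap F E θ) (hspan : Submodule.span F {(1 : E), s} = ⊤)
  (hsq : ¬ IsSquare (algebraMap F (v.adicCompletion F) θ)) (c : E ≃ₐ[F] E) (hc : c s = -s)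

include hc in
/-- **Seat p8's star at `σ = localConj` is this seat's star**, pointwise: both are the local conjugation. -/
theorem star_starRingOfQuadratic_localConj (h2 : finrank (v.adicCompletion F) (w.adicCompletion E) = 2)
    (y : w.adicCompletion E) :
    (letI :=
        starRingOfQuadratic h2 (localConj v w hs hspan hsq c) (localConj_ne_one v w hs hspan hsq c hc);
      star y) =
      (letI := localStarRing v w hs hspan hsq c hc; star y) := by
  rw [← localConj_eq_star v w hs hspan hsq c hc]
  exact star_eq (localConj v w hs hspan hsq c).toRingEquiv _ y

include hs hspan hsq hc in
/-- **The isotropy of `V_v` in the N3 lane's vocabulary:** on `E_w` at every finite non-split place of `F`, with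
seat p8's star `starRingOfQuadratic h2 σ hσ` at `σ = localConj`, every invertible hermitian matrix of size `≥ 3`
has a non-zero vector `x` with `sesqForm H x x = 0` (file 179 transported along
`star_starRingOfQuadratic_localConj`). -/
theorem exists_sesqForm_eq_zero_localConj (h2 : finrank (v.adicCompletion F) (w.adicCompletion E) = 2)
    {ι : Type*} [Fintype ι] [DecidableEq ι] (h3 : 2 < Fintype.card ι) {H : Matrix ι ι (w.adicCompletion E)}
    (hH : letI := starRingOfQuadratic h2 (localConj v w hs hspan hsq c) (localConj_ne_one v w hs hspan hsq c hc)
      H.IsHermitian)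
    (hdet : IsUnit H.det) :
    letI := starRingOfQuadratic h2 (localConj v w hs hspan hsq c) (localConj_ne_one v w hs hspan hsq c hc)
    ∃ x : ι → w.adicCompletion E, x ≠ 0 ∧ sesqForm H x x = 0 := by
  have hst := star_starRingOfQuadratic_localConj (v := v) (w := w) (hs := hs) (hspan := hspan) (hsq := hsq)
    (c := c) (hc := hc) h2
  have hH' : letI := localStarRing v w hs hspan hsq c hc; H.IsHermitian := (isHermitian_congr _ _ hst H).mp hH
  obtain ⟨x, hx0, hx⟩ := exists_formVal_eq_zero_of_nonsplit v w hs hspan hsq c hc h3 hH' hdet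
  exact ⟨x, hx0, (sesqForm_self_eq_formVal _ _ hst H x).trans hx⟩

end Local

end Summit.Ventures.HodgeRepro2.T5HermitianLocalIsotropyN3
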